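import Summits.AtomisticToContinuum.HydrodynamicLimit.Theorems.EnskogAdjointDualityAdjointEnskogTestFamilyRCorrectorBalance
import Summits.AtomisticToContinuum.HydrodynamicLimit.Theorems.EnskogAdjointDualityAdjointEnskogTestFamilyRMaxwellianCharDeriv
import Summits.AtomisticToContinuum.HydrodynamicLimit.Theorems.EnskogAdjointDualityAdjointEnskogTestFamilyRTelescopeProduct
import Literature.Analysis.FunctionSpaces.TorusHolderBridge
import HarnessLib

/-!
# K2R corrector estimate: the registered statement `stub_correctorEstimate` (G4)

Route `EnskogAdjointDuality` of `AtomisticToContinuum/HydrodynamicLimit`, crux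
`AdjointEnskogTestFamilyR` (stmt-AtomisticToContinuum-11592, "K2R"), line `birth`, stub
`stub_correctorEstimate` (G4): the two corrector terms of the Enskog defect of an admissible test
family `φ^N = ψ^N + κ^N/λ_N` along a classical hard-sphere Euler solution are uniformly controlled
on the window `[0, t]`:

* `A_κ(N,s) = ∫_{𝕋³} ∫ Df(s,x,v) κ^N(s,x,v) dv dx` is bounded, `|A_κ| ≤ K` (decay
  `|Df| (1+|v|)⁸ ≤ C_F` of the characteristic derivative of the Euler local Maxwellian,
  `k2r_maxwellian_decay`, against the quadratic growth `|κ| ≤ C(1+|v|²)` of the corrector) —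
  `k2r_correctorEstimate_A`;
* `B_κ(N,s) = ∫_{𝕋³} ∫ f L̃[κ^N]` is `O(ε_N)`, `|B_κ| ≤ K ε_N` (the corrector balance
  `stub_correctorBalance` at the time slice `s`, with the window parameters of the Euler solution:
  bounds and a positive lower bound of `ρ, θ`, a bound of `u`, the spatial Lipschitz constant from
  the bounds of the partial derivatives, the bound of the contact value `Y(σ³ρ)` on the EOS window,
  and `0 ≤ ε_N = σ (N+1)^{-1/3} ≤ σ ≤ 1`) — `k2r_correctorEstimate_B`.

References: C. Cercignani, R. Illner, M. Pulvirenti, *The Mathematical Theory of Dilute Gases*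
(1994), §3.1, §3.3 [CIP1994]; H. Spohn, *Large Scale Dynamics of Interacting Particles* (1991),
Part I §3 [Spohn1991].
-/

noncomputable section

open MeasureTheory ProbabilityTheory Metric Set Filter Topology Function
open scoped InnerProductSpace ENNReal NNReal

namespace Summit.AtomisticToContinuum.HydrodynamicLimit.Theorems.EnskogAdjointDuality

open Literature.Analysis.FluidPDE Literature.MathematicalPhysics.KineticTheory
  Literature.Analysis.FunctionSpaces

section Window

variable {η₁ σ T t : ℝ} {ρ θ : ℝ → T3 → ℝ} {u : ℝ → T3 → V3}

/-! ## The corrector term `A_κ` -/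

/-- **The corrector term `A_κ` is bounded.** For a classical hard-sphere Euler solution on
`[0, T)`, `t ∈ (0, T)`, and correctors of quadratic growth `|κ^N(s,x,v)| ≤ C (1+|v|²)`, the
pairing of the characteristic derivative `Df` of the Euler local Maxwellian (`derivWithin` on
`[0, t]`) with `κ^N` satisfies `|∫_{𝕋³} ∫ Df κ^N dv dx| ≤ K` uniformly in `N` and `s ∈ [0, t]`:
`|Df| ≤ C_F (1+|v|)^{-8}` (`k2r_maxwellian_decay`), so `|Df κ^N| ≤ C_F |C| (1+|v|)^{-4}`,
integrable on `ℝ³` (`k2r_integrable_inv_one_add_norm_pow_four`), and `𝕋³` has unit volume.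
[cite: CIP1994, §3.3] -/
theorem k2r_correctorEstimate_A (hEul : IsHardSphereEulerSolution σ T ρ u θ) (ht : t ∈ Ioo 0 T)
    {κ : ℕ → ℝ → T3 → V3 → ℝ} {C : ℝ} (hκb : ∀ N s x v, |κ N s x v| ≤ C * (1 + ‖v‖ ^ 2)) :
    ∃ K : ℝ, ∀ N, ∀ s ∈ Icc 0 t,
      |∫ x : T3, ∫ v : V3, derivWithin (fun r : ℝ =>
          ρ r ((Torus.geometry (Fin 3)).translate x ((r - s) • v)) *
            localMaxwellian 1 (θ r ((Torus.geometry (Fin 3)).translate x ((r - s) • v)))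
              (u r ((Torus.geometry (Fin 3)).translate x ((r - s) • v))) v) (Icc 0 t) s *
        κ N s x v| ≤ K := by
  obtain ⟨CF, hCF⟩ := k2r_maxwellian_decay hEul ht.1 ht.2
  set Z : ℝ := ∫ v : V3, ((1 + ‖v‖) ^ 4)⁻¹
  refine ⟨CF * |C| * Z, fun N s hs => ?_⟩
  -- the velocity integral at a fixed position
  have hv : ∀ x : T3,
      |∫ v : V3, derivWithin (fun r : ℝ =>
          ρ r ((Torus.geometry (Fin 3)).translate x ((r - s) • v)) *
            localMaxwellian 1 (θ r ((Torus.geometry (Fin 3)).translate x ((r - s) • v)))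
              (u r ((Torus.geometry (Fin 3)).translate x ((r - s) • v))) v) (Icc 0 t) s *
        κ N s x v| ≤ CF * |C| * Z := by
    intro x
    have hbound : ∀ v : V3,
        ‖derivWithin (fun r : ℝ =>
            ρ r ((Torus.geometry (Fin 3)).translate x ((r - s) • v)) *
              localMaxwellian 1 (θ r ((Torus.geometry (Fin 3)).translate x ((r - s) • v)))
                (u r ((Torus.geometry (Fin 3)).translate x ((r - s) • v))) v) (Icc 0 t) s *
          κ N s x v‖ ≤ CF * |C| * ((1 + ‖v‖) ^ 4)⁻¹ := by
      intro v
      have h1 := (hCF s hs x v).2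
      simp only [Torus.geometry_translate]
      set D : ℝ := derivWithin (fun r : ℝ => ρ r (x + Torus.proj ((r - s) • v)) *
          localMaxwellian 1 (θ r (x + Torus.proj ((r - s) • v)))
            (u r (x + Torus.proj ((r - s) • v))) v) (Icc 0 t) s
      have ha : (1 : ℝ) ≤ 1 + ‖v‖ := le_add_of_nonneg_right (norm_nonneg v)
      have hκ' : |κ N s x v| ≤ |C| * (1 + ‖v‖) ^ 2 :=
        (hκb N s x v).trans ((mul_le_mul_of_nonneg_right (le_abs_self C) (by positivity)).trans
          (mul_le_mul_of_nonneg_left (by nlinarith [norm_nonneg v]) (abs_nonneg C)))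
      have key : |D| * |κ N s x v| * (1 + ‖v‖) ^ 4 ≤ CF * |C| :=
        calc |D| * |κ N s x v| * (1 + ‖v‖) ^ 4 ≤ |D| * (|C| * (1 + ‖v‖) ^ 2) * (1 + ‖v‖) ^ 4 := by
              gcongr
          _ = |C| * (|D| * (1 + ‖v‖) ^ 6) := by ring
          _ ≤ |C| * (|D| * (1 + ‖v‖) ^ 8) :=
              mul_le_mul_of_nonneg_left (mul_le_mul_of_nonneg_left
                (pow_le_pow_right₀ ha (by norm_num)) (abs_nonneg D)) (abs_nonneg C)
          _ ≤ |C| * CF := by gcongr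
          _ = CF * |C| := mul_comm _ _
      rw [Real.norm_eq_abs, abs_mul, ← div_eq_mul_inv, le_div_iff₀ (by positivity)]
      exact key
    have h := norm_integral_le_of_norm_le
      (k2r_integrable_inv_one_add_norm_pow_four.const_mul (CF * |C|)) (Eventually.of_forall hbound)
    rw [integral_const_mul, Real.norm_eq_abs] at h
    exact h
  -- the `x`-integral over the probability space `𝕋³`
  have h := norm_integral_le_of_norm_le_const (μ := (volume : Measure T3)) (C := CF * |C| * Z)
    (Eventually.of_forall fun x => by rw [Real.norm_eq_abs]; exact hv x)
  rw [Real.norm_eq_abs, probReal_univ, mul_one] at h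
  exact h

/-! ## The corrector term `B_κ` -/

/-- **The corrector term `B_κ` is `O(ε_N)`.** For a classical hard-sphere Euler solution on
`[0, T)` in the EOS window (`f_ex` analytic on `(0, η₁)`, packing `ρσ³ < η₁` on `[0, t]`,
`0 < σ ≤ 1`), `t ∈ (0, T)`, and correctors `κ^N` of quadratic growth and weighted Lipschitz
constant `C`, the pairing of the Euler local Maxwellian `f = ρ M_{1,θ,u}` with the corrector part of
the test-side Enskog operator, `∫_{𝕋³} ∫ f ∫_{S²} ∫ ((v−w)·ω)₊ Y(σ³ρ(x+ε_Nω/2)) f(x+ε_Nω, w)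
[κ(x,v′) + κ(x+ε_Nω,w′) − κ(x,v) − κ(x+ε_Nω,w)]`, is `≤ K ε_N` in absolute value, uniformly in
`N` and `s ∈ [0, t]`: the corrector balance `stub_correctorBalance` at the slice `s`, with the
window constants of the solution (bounds and positive lower bounds of `ρ, θ`, a bound of `u`, the
spatial Lipschitz constant `√3 · 3B` from the bound `B` of the partial derivatives, the bound of the
contact value on the window) and `0 ≤ ε_N ≤ σ ≤ 1`. [cite: CIP1994, §3.1] -/
theorem k2r_correctorEstimate_B (hA : AnalyticOnNhd ℝ hsExcessFreeEnergy (Ioo 0 η₁)) (hσ : 0 < σ)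
    (hσ1 : σ ≤ 1) (hEul : IsHardSphereEulerSolution σ T ρ u θ) (ht : t ∈ Ioo 0 T)
    (hguard : ∀ s ∈ Icc 0 t, ∀ x, ρ s x * σ ^ 3 < η₁) {κ : ℕ → ℝ → T3 → V3 → ℝ}
    (hκc : ∀ N, Continuous fun p : ℝ × T3 × V3 => κ N p.1 p.2.1 p.2.2) {C : ℝ}
    (hκb : ∀ N s x v, |κ N s x v| ≤ C * (1 + ‖v‖ ^ 2))
    (hκL : ∀ N s x x' v v',
      |κ N s x v - κ N s x' v'| ≤ C * (1 + ‖v‖ ^ 2 + ‖v'‖ ^ 2) * (dist x x' + ‖v - v'‖)) :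
    ∃ K : ℝ, ∀ N, ∀ s ∈ Icc 0 t,
      |∫ x : T3, ∫ v : V3, ρ s x * localMaxwellian 1 (θ s x) (u s x) v *
        ∫ ω : sphere (0 : V3) 1, (∫ w : V3,
          max ⟪v - w, (ω : V3)⟫_ℝ 0 *
          (3 / (2 * Real.pi) * deriv hsExcessFreeEnergy
            (σ ^ 3 * ρ s ((Torus.geometry (Fin 3)).translate x ((hsDiameter σ N / 2) • (ω : V3))))) *
          (ρ s ((Torus.geometry (Fin 3)).translate x (hsDiameter σ N • (ω : V3))) *
            localMaxwellian 1
              (θ s ((Torus.geometry (Fin 3)).translate x (hsDiameter σ N • (ω : V3))))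
              (u s ((Torus.geometry (Fin 3)).translate x (hsDiameter σ N • (ω : V3)))) w) *
          (κ N s x (v - ⟪v - w, (ω : V3)⟫_ℝ • (ω : V3)) +
            κ N s ((Torus.geometry (Fin 3)).translate x (hsDiameter σ N • (ω : V3)))
              (w + ⟪v - w, (ω : V3)⟫_ℝ • (ω : V3)) -
            κ N s x v -
            κ N s ((Torus.geometry (Fin 3)).translate x (hsDiameter σ N • (ω : V3))) w))
        ∂sphereMeasure| ≤ K * hsDiameter σ N := by
  -- window constants of the Euler solution on `[0, t]`
  obtain ⟨R, U, θm, Θ, B, hθm, hB0, hR, hU, hΘ, -, hP, -⟩ := k2r_eulerWindow hEul ht.1.le ht.2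
  obtain ⟨hρc, -, -, -⟩ := eulerProfiles_window hEul ht.2 (t := t)
  obtain ⟨ρm, hρm, hρm'⟩ := k2r_exists_pos_le_window ht.1.le hρc fun s hs x => (hR s hs x).1
  obtain ⟨hYc, Yb, hYb⟩ := contactValue_window (t := t) hσ hA hρc (fun s hs x => (hR s hs x).1) hguard
  -- the spatial Lipschitz constant from the bound of the partial derivatives
  set M : Fin 3 → ℝ≥0 := fun _ => ⟨B, hB0⟩
  set Lb : ℝ := ((NNReal.sqrt (Fintype.card (Fin 3)) * ∑ i, M i : ℝ≥0) : ℝ)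
  -- the corrector balance constant
  obtain ⟨K, hK0, hK⟩ := stub_correctorBalance ρm R θm Θ U Lb Yb hρm hθm
  refine ⟨K * |C|, fun N s hs => ?_⟩
  have hsT : s ∈ Ico 0 T := ⟨hs.1, hs.2.trans_lt ht.2⟩
  -- the time slices of the fields
  have hρs : Torus.IsSmooth (ρ s) := hEul.smooth_density.isSmooth_slice hsT
  have hθs : Torus.IsSmooth (θ s) := hEul.smooth_temperature.isSmooth_slice hsT
  have hus : Torus.IsSmooth (u s) := hEul.smooth_velocity.isSmooth_slice hsT
  have hLρ : LipschitzWith (NNReal.sqrt (Fintype.card (Fin 3)) * ∑ i, M i) (ρ s) :=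
    Torus.lipschitzWith_of_norm_partialDeriv_le (hρs.isContDiff (by simp)) fun i x => by
      rw [Real.norm_eq_abs]; exact (hP s hs x i).1
  have hLθ : LipschitzWith (NNReal.sqrt (Fintype.card (Fin 3)) * ∑ i, M i) (θ s) :=
    Torus.lipschitzWith_of_norm_partialDeriv_le (hθs.isContDiff (by simp)) fun i x => by
      rw [Real.norm_eq_abs]; exact (hP s hs x i).2.1
  have hLu : LipschitzWith (NNReal.sqrt (Fintype.card (Fin 3)) * ∑ i, M i) (u s) :=
    Torus.lipschitzWith_of_norm_partialDeriv_le (hus.isContDiff (by simp)) fun i x =>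
      (hP s hs x i).2.2
  have hLip : ∀ x x', |ρ s x - ρ s x'| ≤ Lb * dist x x' ∧ |θ s x - θ s x'| ≤ Lb * dist x x' ∧
      ‖u s x - u s x'‖ ≤ Lb * dist x x' := fun x x' =>
    ⟨by rw [← Real.dist_eq]; exact hLρ.dist_le_mul x x',
     by rw [← Real.dist_eq]; exact hLθ.dist_le_mul x x',
     by rw [← dist_eq_norm]; exact hLu.dist_le_mul x x'⟩
  -- the scaling
  set ε : ℝ := hsDiameter σ N
  have hε0 : 0 ≤ ε := (hsDiameter_pos hσ N).le
  have hε1 : ε ≤ 1 := (hsDiameter_le hσ.le N).trans hσ1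
  -- the contact factor `Y(σ³ρ_s(x + εω/2))`
  set Yf : T3 → sphere (0 : V3) 1 → ℝ := fun x ω => 3 / (2 * Real.pi) *
    deriv hsExcessFreeEnergy (σ ^ 3 * ρ s ((Torus.geometry (Fin 3)).translate x ((ε / 2) • (ω : V3))))
  have hYfc : Continuous (uncurry Yf) := by
    have hmap : Continuous fun p : T3 × sphere (0 : V3) 1 =>
        ((s, (Torus.geometry (Fin 3)).translate p.1 ((ε / 2) • (p.2 : V3))) : ℝ × T3) :=
      continuous_const.prodMk (continuous_torus_translate_sphere (ε / 2))
    exact hYc.comp_continuous hmap fun p => ⟨hs, mem_univ _⟩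
  have hYfb : ∀ x ω, |Yf x ω| ≤ Yb := fun x ω => hYb s hs _
  -- the corrector slice `κ^N(s, ·, ·)`
  have hκsc : Continuous (uncurry (κ N s)) :=
    (hκc N).comp (continuous_const.prodMk continuous_id)
  have h := hK (ρ s) (θ s) (u s) hρs.continuous hθs.continuous hus.continuous
    (fun x => ⟨hρm' s hs x, (hR s hs x).2⟩) (fun x => hΘ s hs x) (fun x => hU s hs x) hLip
    Yf hYfc hYfb (κ N s) hκsc C (hκb N s) (hκL N s) ε hε0 hε1
  refine h.trans ?_
  have hCC : K * C * ε ≤ K * |C| * ε :=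
    mul_le_mul_of_nonneg_right (mul_le_mul_of_nonneg_left (le_abs_self C) hK0) hε0
  exact hCC

end Window

/-! ## The registered statement -/

/-- **Corrector estimate (stub G4 of the K2R line `birth`, registered Prop `CorrectorEstimate`).**
Along a classical hard-sphere Euler solution in the EOS window, for an admissible test family with
correctors `κ^N` (quadratic growth, weighted Lipschitz constant `C`), uniformly in `N` and
`s ∈ [0, t]`: `|A_κ(N,s)| = |∫∫ Df κ^N| ≤ K` (decay of `Df` against the quadratic growth of `κ^N`,
`k2r_correctorEstimate_A`) and `|B_κ(N,s)| = |∫∫ f L̃[κ^N]| ≤ K ε_N` (the corrector balance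
`stub_correctorBalance` with the window parameters of the solution, `0 ≤ ε_N ≤ σ ≤ 1`,
`k2r_correctorEstimate_B`). In the crux these feed clause (v): `λ_N⁻¹ A_κ → 0` and `½ B_κ → 0`.
[cite: CIP1994, §3.1] -/
theorem stub_correctorEstimate :
  ∀ (η₁ : ℝ), 0 < η₁ → AnalyticOnNhd ℝ Literature.MathematicalPhysics.KineticTheory.hsExcessFreeEnergy (Set.Ioo 0 η₁) →
  ∀ (σ T : ℝ), 0 < σ → σ ≤ 1 → ∀ (ρ θ : ℝ → UnitAddTorus (Fin 3) → ℝ) (u : ℝ → UnitAddTorus (Fin 3) → EuclideanSpace ℝ (Fin 3)),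
  Literature.MathematicalPhysics.KineticTheory.IsHardSphereEulerSolution σ T ρ u θ →
  ∀ t ∈ Set.Ioo 0 T, (∀ s ∈ Set.Icc 0 t, ∀ x, ρ s x * σ ^ 3 < η₁) →
  ∀ (c : ℕ → ℝ → UnitAddTorus (Fin 3) → ℝ × EuclideanSpace ℝ (Fin 3) × ℝ) (κ : ℕ → ℝ → UnitAddTorus (Fin 3) → EuclideanSpace ℝ (Fin 3) → ℝ),
  (∀ N, Continuous (Function.uncurry (c N))) →
  (∀ N, Continuous (fun p : ℝ × UnitAddTorus (Fin 3) × EuclideanSpace ℝ (Fin 3) => κ N p.1 p.2.1 p.2.2)) →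
  ∀ (C : ℝ), (∀ N s x x' v v', ‖c N s x‖ ≤ C ∧ dist (c N s x) (c N s x') ≤ C * dist x x' ∧ |κ N s x v| ≤ C * (1 + ‖v‖ ^ 2) ∧
    |κ N s x v - κ N s x' v'| ≤ C * (1 + ‖v‖ ^ 2 + ‖v'‖ ^ 2) * (dist x x' + ‖v - v'‖)) →
  (let G := Literature.Analysis.FluidPDE.Torus.geometry (Fin 3)
   let ε := fun N : ℕ => Literature.MathematicalPhysics.KineticTheory.hsDiameter σ N
   let f := fun (s : ℝ) (x : UnitAddTorus (Fin 3)) (v : EuclideanSpace ℝ (Fin 3)) => ρ s x * Literature.Analysis.FluidPDE.localMaxwellian 1 (θ s x) (u s x) v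
   let Y := fun η : ℝ => 3 / (2 * Real.pi) * deriv Literature.MathematicalPhysics.KineticTheory.hsExcessFreeEnergy η
   let Lκ := fun (N : ℕ) (s : ℝ) (x : UnitAddTorus (Fin 3)) (v : EuclideanSpace ℝ (Fin 3)) => ∫ ω : Metric.sphere (0 : EuclideanSpace ℝ (Fin 3)) 1, (let y := G.translate x (ε N • (ω : EuclideanSpace ℝ (Fin 3))); ∫ w : EuclideanSpace ℝ (Fin 3), max (inner ℝ (v - w) ω) 0 * Y (σ ^ 3 * ρ s (G.translate x ((ε N / 2) • (ω : EuclideanSpace ℝ (Fin 3))))) * f s y w * (κ N s x (v - inner ℝ (v - w) ω • (ω : EuclideanSpace ℝ (Fin 3))) + κ N s y (w + inner ℝ (v - w) ω • (ω : EuclideanSpace ℝ (Fin 3))) - κ N s x v - κ N s y w)) ∂Literature.MathematicalPhysics.KineticTheory.sphereMeasure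
   let Df := fun (s : ℝ) (x : UnitAddTorus (Fin 3)) (v : EuclideanSpace ℝ (Fin 3)) => derivWithin (fun r : ℝ => f r (G.translate x ((r - s) • v)) v) (Set.Icc 0 t) s
   let Aκ := fun (N : ℕ) (s : ℝ) => ∫ x : UnitAddTorus (Fin 3), ∫ v : EuclideanSpace ℝ (Fin 3), Df s x v * κ N s x v
   let Bκ := fun (N : ℕ) (s : ℝ) => ∫ x : UnitAddTorus (Fin 3), ∫ v : EuclideanSpace ℝ (Fin 3), f s x v * Lκ N s x v
   ∃ K : ℝ, ∀ (N : ℕ), ∀ s ∈ Set.Icc 0 t, |Aκ N s| ≤ K ∧ |Bκ N s| ≤ K * ε N) := by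
  intro η₁ _hη₁ hA σ T hσ hσ1 ρ θ u hEul t ht hguard c κ _hc hκc C hadm G ε f Y Lκ Df Aκ Bκ
  obtain ⟨KA, hKA⟩ := k2r_correctorEstimate_A hEul ht (κ := κ) (C := C)
    fun N s x v => (hadm N s x x v v).2.2.1
  obtain ⟨KB, hKB⟩ := k2r_correctorEstimate_B hA hσ hσ1 hEul ht hguard hκc
    (fun N s x v => (hadm N s x x v v).2.2.1) fun N s x x' v v' => (hadm N s x x' v v').2.2.2
  refine ⟨max KA KB, fun N s hs => ⟨(hKA N s hs).trans (le_max_left _ _), (hKB N s hs).trans ?_⟩⟩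
  exact mul_le_mul_of_nonneg_right (le_max_right _ _) (hsDiameter_pos hσ N).le

end Summit.AtomisticToContinuum.HydrodynamicLimit.Theorems.EnskogAdjointDuality

end
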